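import Summits.Ventures.CertifiedManyBodySolver.Theses.CovHg1201M19P10
import Summits.Ventures.CertifiedManyBodySolver.Downfold.BoxesHg1201EP10KinematicCoverN
import HarnessLib

/-!
# Theorems/CovHg1201M19P10StubBottomNLow.lean — route «CovHg1201M19P10» (HgBa₂CuO₄₊δ «Hg-1201» @ 10 GPa, D-0154 (1)(C)), crux «PatchBottomP10»
# (stmt-Ventures-27105): the registered stub `stub_bottomP10_nLow : BottomNLowP10` DISCHARGED — state-free, no certificate

Supports stmt-Ventures-27105. The PEN's BC3 birth skeleton (`cov/hg1201-P10/bc/PatchBottomP10_birth.lean`, planner hubbard-obs-lead g19, registered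
2026-08-28T09:34:14Z) splits «PatchBottomP10» by DENSITY at the captain's cut `n_k′ = 43/50` (RULING 09:00:42Z): `stub_bottomP10_nHigh : BottomNHighP10`
(`n ∈ [43/50, 22/25]`, certificate-bearing) and `stub_bottomP10_nLow : BottomNLowP10` (`n ∈ [21/25, 43/50]`). The low-density piece is EXACTLY the state-free
part landed by hubbard-cov-hg1201-box-2 g0 (`Downfold.hg1201M19P10_patchBottomP10_lowDensity_kinematic`, p621284: the `M = 512` kernel pair-table row
`B(−49/100, 4301/8192) ≤ 0.2502620098`, the chord level at `−47/100`, joint convexity of the half-bathtub in the slot, and the torus-limit variational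
inequality `orbitMean_neg_oddMomentTT_lam_zero_ge_kinematic_of_gs` — every slot `σ ∈ [−49/100, −47/100]`, every source `s`, every label): the stub body is
re-homed here VERBATIM and closed by that theorem. Seat hubbard-cov-hg1201-box-2 g1 (`prover-hubbard-cov-hg1201-box-2-g0-0`, @10 box lane, captain RULING
«BOX LANE SPLIT @0 / @10» 2026-08-28T10:09:32Z).
HONEST FRAMING: one-body kinematics + set algebra, kernel-checked, zero solve, no claim node; nothing interaction-sensitive is certified; the crux
«PatchBottomP10» stays OPEN on its strip `n ∈ [43/50, 22/25]` (stub `stub_bottomP10_nHigh`, certificate-bearing); certified stiffness-scale CEILINGS on a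
downfolded screening-grade box = CONTROL / CALIBRATION + labelled heuristic (wording class (xx1); «content» = below `0.98 ×` the kinematic MAJORANT word
`0.4864908`, no suppression below free claimed); a ceiling never speaks to the presence of superconductivity; not a `T_c`, phase or `dT_c/dP` sentence;
nothing here is a statement about HgBa₂CuO₄₊δ; NO item, rung leaf or summit statement is proved by this file.
References: E. H. Lieb, M. Loss, Duke Math. J. 71 (1993) 337, §8 [LiebLoss1993]; T. Hazra, N. Verma, M. Randeria, PRX 9 (2019) 031049, eqs. (2)–(6)
[HazraVermaRanderia2019]; D. J. Scalapino, S. R. White, S.-C. Zhang, PRB 47 (1993) 7995, §II [ScalapinoWhiteZhang1993].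
-/

noncomputable section

namespace Summit.Ventures.CertifiedManyBodySolver.Theorems.CovHg1201M19P10Stubs

open Set Filter Topology
open Summit.Ventures.CertifiedManyBodySolver.Observables
open Summit.Ventures.CertifiedManyBodySolver.Downfold
open Literature.MathematicalPhysics.QuantumLattice Literature.MathematicalPhysics.QuantumLattice.ThermodynamicLimit
open Literature.Probability.LatticeModels
open Matrix HubbardWave0
open scoped BigOperators ComplexOrder

/-- The registered stub statement `BottomNLowP10` of crux «PatchBottomP10» (stmt-Ventures-27105), VERBATIM from the PEN's BC3 birth skeleton
`cov/hg1201-P10/bc/PatchBottomP10_birth.lean` (re-homed in this namespace): the bottom bundle of the P10 corner patch on the LOWER density segment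
`n ∈ [21/25, 43/50]` — for every slot `σ ∈ [−49/100, −47/100]`, every source `s ∈ [−49/100, σ]` and every torus limit of unit `(rectN n L, S^z = 0)`-sector
ground states of `hubbardTorusTT' L 1 s 3`: `−0.4767609 ≤ |D₄|⁻¹ Σ_γ Re ω_γ(−X₀(σ, 3))` (a route-local obligation shape, not a literature fact). -/
def BottomNLowP10 : Prop :=
    ∀ n ∈ Icc (21 / 25 : ℝ) (43 / 50), ∀ σ ∈ Icc (-49 / 100 : ℝ) (-47 / 100), ∀ s ∈ Icc (-49 / 100 : ℝ) σ,
    ∀ (ω : InfVolFermionState 2) (Ls : ℕ → ℕ) (ψ : ∀ L, Fock (Orb (FermionTorus 2 L))),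
    Tendsto Ls atTop atTop →
    (∀ j, IsGroundStateInSector (hubbardTorusTT' (Ls j) 1 s 3) (rectN n (Ls j)) 0 (ψ (Ls j))) →
    (∀ j, star (ψ (Ls j)) ⬝ᵥ ψ (Ls j) = 1) → ω.IsTorusLimitOf ψ Ls →
    -(4767609 / 10000000 : ℝ) ≤ ((Finset.univ : Finset (DihedralGroup 4)).card : ℝ)⁻¹ * ∑ g ∈ (Finset.univ : Finset (DihedralGroup 4)),
      (ω.expect (d4ShiftSet g 0 (box 2 7)) (fermionEmbed (PolySite.d4Emb g 0 (box 2 7)) (-oddMomentObsTT σ 3 0))).re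

/-- **Registered stub `stub_bottomP10_nLow` of stmt-Ventures-27105, DISCHARGED state-free**: the whole lower density segment `n ∈ [21/25, 43/50]` of the
bottom bundle is one-body kinematics (hubbard-cov-hg1201-box-2 g0's `hg1201M19P10_patchBottomP10_lowDensity_kinematic`: `M = 512` kernel row at
`t′ = −49/100`, chord level at `−47/100`, joint convexity in the slot, torus-limit variational inequality); no ground-state certificate enters.
[cite: LiebLoss1993, §8, Theorem 8.2] [cite: HazraVermaRanderia2019, eqs. (2)-(6)] -/
theorem stub_bottomP10_nLow : BottomNLowP10 :=
  fun n hn σ hσ s hs ω Ls ψ hLs hψ h1 hω =>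
    hg1201M19P10_patchBottomP10_lowDensity_kinematic n hn σ hσ s hs ω Ls ψ hLs hψ h1 hω

end Summit.Ventures.CertifiedManyBodySolver.Theorems.CovHg1201M19P10Stubs

end
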